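import Mathlib.FieldTheory.IntermediateField.Adjoin.Basic
import Mathlib.FieldTheory.IntermediateField.Algebraic
import Mathlib.RingTheory.Finiteness.Basic
import Mathlib.RingTheory.Noetherian.Basic
import HarnessLib

/-!
# The scalars moving a vector into a lattice form a finitely generated module;
# eigenvalues of lattice-preserving operators lie in a finite extension

Topic `Algebra/Module`; namespace `Literature.Algebra.Module`.
Definitions with bodies and theorems; no named fact, no `sorry`.

Let `R → k'` (`k'` a field), `H` a `k'`-vector space, `L ⊆ H` a finitely generated `R`-submodule
(`R` Noetherian) and `η ∈ H`, `η ≠ 0`.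

* `scalingSubmodule L η = {c ∈ k' | c • η ∈ L}`, an `R`-submodule of `k'`, **finitely generated**
  (`scalingSubmodule_fg`: `c ↦ c • η` embeds it into the Noetherian module `L`);
* every eigenvalue `a` (`T η = a • η`) of a `k'`-linear operator `T` preserving `L`, with `η ∈ L`,
  lies in `scalingSubmodule L η` (`eigenvalue_mem_scalingSubmodule`);
* **`exists_intermediateField_scalingSubmodule_subset`** — for `k'/K` algebraic (`R → K → k'`),
  `scalingSubmodule L η` is contained in an intermediate field `E`, finite over `K`.  Hence ALL the
  eigenvalues on `η` of ALL the `L`-preserving operators lie in one finite extension `E/K` —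
  e.g. a Hecke eigensystem occurring in `H^i(X_K, ℳ_ξ) ⊗ ℚ̄_p` takes values in a finite `E/ℚ_p`
  once an integral structure is known to be finitely generated [Scholze2015, §V.4].

## References

* N. Bourbaki, *Algèbre commutative*, Ch. V §1 (integrality via finitely generated modules).
  [folklore]
* P. Scholze, Ann. of Math. 182 (2015), §V.4. [Scholze2015]
-/

noncomputable section

namespace Literature.Algebra.Module

variable {R k' : Type*} [CommRing R] [Field k'] [Algebra R k'] {H : Type*} [AddCommGroup H]
  [Module k' H] [Module R H] [IsScalarTower R k' H] (L : Submodule R H) (η : H)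

variable (k') in
/-- **The scalars moving `η` into `L`**: `{c ∈ k' | c • η ∈ L}`, an `R`-submodule of `k'`.
[folklore] -/
def scalingSubmodule : Submodule R k' where
  carrier := {c | c • η ∈ L}
  zero_mem' := by simp
  add_mem' {c c'} hc hc' := by
    change (c + c') • η ∈ L
    rw [add_smul]
    exact L.add_mem hc hc'
  smul_mem' r c hc := by
    change (r • c) • η ∈ L
    rw [smul_assoc]
    exact L.smul_mem r hc

/-- Membership in `scalingSubmodule`. [folklore] -/
theorem mem_scalingSubmodule_iff (c : k') : c ∈ scalingSubmodule k' L η ↔ c • η ∈ L :=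
  Iff.rfl

variable (k') in
/-- `c ↦ c • η`, the `R`-linear map `scalingSubmodule L η → L`. [folklore] -/
def scalingToLattice : scalingSubmodule k' L η →ₗ[R] L where
  toFun c := ⟨(c : k') • η, c.2⟩
  map_add' c c' := Subtype.ext (add_smul (c : k') (c' : k') η)
  map_smul' r c := Subtype.ext (smul_assoc r (c : k') η)

/-- `c ↦ c • η` is injective for `η ≠ 0`. [folklore] -/
theorem scalingToLattice_injective (hη : η ≠ 0) : Function.Injective (scalingToLattice k' L η) := by
  intro c c' h
  have h' : (c : k') • η = (c' : k') • η := congrArg Subtype.val h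
  exact Subtype.ext (smul_left_injective k' hη h')

variable (k') in
/-- **`scalingSubmodule L η` is finitely generated** for `L` finitely generated over a Noetherian
`R` and `η ≠ 0`. [folklore] -/
theorem scalingSubmodule_fg [IsNoetherianRing R] (hL : L.FG) (hη : η ≠ 0) :
    (scalingSubmodule k' L η).FG := by
  haveI : IsNoetherian R L := isNoetherian_of_fg_of_noetherian L hL
  rw [← Module.Finite.iff_fg]
  exact Module.Finite.of_injective (scalingToLattice k' L η) (scalingToLattice_injective L η hη)

/-- **Eigenvalues of lattice-preserving operators lie in `scalingSubmodule L η`** (for `η ∈ L`).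
[folklore] -/
theorem eigenvalue_mem_scalingSubmodule (T : H →ₗ[k'] H) (hT : ∀ v ∈ L, T v ∈ L) (hηL : η ∈ L)
    (a : k') (ha : T η = a • η) : a ∈ scalingSubmodule k' L η := by
  rw [mem_scalingSubmodule_iff, ← ha]
  exact hT η hηL

/-! ### A finite extension containing all the eigenvalues -/

variable (K : Type*) [Field K] [Algebra K k'] [Algebra R K] [IsScalarTower R K k']

/-- **All of `scalingSubmodule L η` lies in one finite extension `E/K`** when `k'/K` is algebraic,
`L` is finitely generated over a Noetherian `R ⊆ K`, and `η ≠ 0`. [folklore] -/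
theorem exists_intermediateField_scalingSubmodule_subset [IsNoetherianRing R]
    [Algebra.IsAlgebraic K k'] (hL : L.FG) (hη : η ≠ 0) :
    ∃ E : IntermediateField K k', FiniteDimensional K E ∧
      ∀ c ∈ scalingSubmodule k' L η, c ∈ E := by
  obtain ⟨G, hG⟩ := scalingSubmodule_fg k' L η hL hη
  refine ⟨IntermediateField.adjoin K (G : Set k'), ?_, ?_⟩
  · exact IntermediateField.finiteDimensional_adjoin fun x _ =>
      (Algebra.IsAlgebraic.isAlgebraic (R := K) x).isIntegral
  · intro c hc
    rw [← hG] at hc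
    have hle : Submodule.span R (G : Set k') ≤
        ((IntermediateField.adjoin K (G : Set k')).toSubalgebra.toSubmodule).restrictScalars R := by
      rw [Submodule.span_le]
      intro g hg
      exact IntermediateField.subset_adjoin K _ hg
    exact hle hc

/-- **All eigenvalues on `η` of all `L`-preserving operators lie in one finite extension `E/K`.**
[cite: Scholze2015, §V.4] -/
theorem exists_intermediateField_forall_eigenvalue_mem [IsNoetherianRing R]
    [Algebra.IsAlgebraic K k'] (hL : L.FG) (hηL : η ∈ L) (hη : η ≠ 0) :
    ∃ E : IntermediateField K k', FiniteDimensional K E ∧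
      ∀ (T : H →ₗ[k'] H), (∀ v ∈ L, T v ∈ L) → ∀ a : k', T η = a • η → a ∈ E := by
  obtain ⟨E, hE, hsub⟩ := exists_intermediateField_scalingSubmodule_subset (k' := k') L η K hL hη
  exact ⟨E, hE, fun T hT a ha => hsub a (eigenvalue_mem_scalingSubmodule L η T hT hηL a ha)⟩

end Literature.Algebra.Module
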